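import Summits.Ventures.Crystal3D.Theorems.StickyWulffConstantGenericWallFloorBarlowOrientedGlueOneSidedAtTiltWide
import Summits.Ventures.Crystal3D.Theorems.StickyWulffConstantGenericWallFloorBarlowOrientedGlueOneSidedTopAtTiltWide
import Summits.Ventures.Crystal3D.Theorems.StickyWulffConstantGenericWallFloorBarlowLineCountApartTiltWide
import HarnessLib

/-!
# F4 glue for BOTH plates up-presented, chosen slots, TWO steered verticals `z₁, z₂`, WIDE tilt 1/3 — EDGE-ON option (ε₂), brick G3
# (lane T crux `TextureLiminfV5`, stmt-Ventures-23912, sub-crux EDGE-ON `stub_edgeOn`; cf-p1 Q-ε₂ (cxvii)(2), 19480-p2 g12)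

HONEST FRAMING. Venture `Summits/Ventures/Crystal3D` (cell `crystal3d-full`), route `route-Ventures-StickyWulffConstant`, helper `--supports` the
law-v5 crux `TextureLiminfV5` (stmt-Ventures-23912), registered line `TexShadow` v8.5, open stub `stub_edgeOn` (K4).  Rung credit only; F-C1 not moved; NOT
the stub.  Inputs BY NAME: E1 (`ExactOnly`), `DoubleStarCoaxialAt` / `CapPairCoaxial`.

The two one-sided steered glues `barlow_hlines_oriented_oneSided_at_tiltWide` (bottom plate, up along `e₃`, steering `z₁`) and
`barlow_hlines_oriented_oneSided_top_at_tiltWide` (top plate, up along `−e₃`, steering `z₂`) MERGED through the two-family steered line count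
`barlow_lineCount_le_payers_apart_tiltWide` (G2): both plates up-presented (`0 ≤ (L₁⁻¹e₃)₂`, `0 ≤ (L₂⁻¹(−e₃))₂`), launch slots `v₁`, `v₂` steep for
`z₁`, `z₂` (‖z₁ − e₃‖ ≤ 1/3, ‖z₂ + e₃‖ ≤ 1/3), ∇-steps the `zᵢ`-best cappers with `±e₃`-rise `≥ 1/4` assumed on ∇-bilayers (`hrq₁`, `hrq₂`, engine-checked
per box), clauses (i) `hapart₁`, (ii) `hapart₂` and the steered pair clause (iii)_z `hsep`.  Output = the TWO-family `hlines` shape of wulff-p2's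
`bilayerWallAt_of_lineCount` but along `IsUpBond` step sequences (rises `≥ 1/4`): in every cell ONE margin `m = 15 + 24h + 96R₀` and finite line sets `T₁`, `T₂`
through the two height windows with `#T₁ + #T₂ + 18·m·ρ ≤ Σ_PAY (12 − deg) + (432 + 1728R₀)(1 + h)ρ`.
* **`barlow_hlines_oriented_apart_at_tiltWide`** (`C_w = 432 + 1728R₀`, the one-family constant: the rim term only absorbs the common margin).
WHAT THIS IS NOT: not the T-side cell inequality (the two-family `IsUpBond` cell glue is the next file); not the mirrored presentations; the EDGE-ON corner
(no up-slot of e₃-rise ≥ 0.4354 on a plate) is untouched; F-C1 not moved.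
-/

noncomputable section

namespace Summit.Ventures.Crystal3D.Theorems

open Finset
open Literature.MathematicalPhysics.StatisticalMechanics
open Summit.Ventures.Crystal3D.Cruxes.TextureLiminf.TexShadow (stacking cyl upSlot₁ upSlot₂ upSlot₃ bilayerRise)
open scoped InnerProductSpace

open scoped Classical in
/-- **F4 glue for BOTH up-presented plates, chosen slots `v₁`, `v₂` steep for the steerings `z₁`, `z₂`, clauses (i), (ii), (iii)_z.**  See the module
docstring. -/
theorem barlow_hlines_oriented_apart_at_tiltWide
    {sE : EuclideanSpace ℝ (Fin 3)} (hsE : sE ∈ fccSlots) (hcert : ExactOnly 0 (fccSlots.filter fun w => 0 < ⟪w, sE⟫_ℝ))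
    (hDS : ∀ F₁ F₂ : EuclideanSpace ℝ (Fin 3) ≃ₗᵢ[ℝ] EuclideanSpace ℝ (Fin 3), DoubleStarCoaxialAt F₁ F₂) (hCP : CapPairCoaxial)
    {σ₁ σ₂ : ℤ → ℤ} (hσ₁ : IsHaggSeq σ₁) (hσ₂ : IsHaggSeq σ₂)
    (L₁ L₂ : EuclideanSpace ℝ (Fin 3) ≃ₗᵢ[ℝ] EuclideanSpace ℝ (Fin 3)) (s₁ s₂ : EuclideanSpace ℝ (Fin 3))
    (hax₁ : 0 ≤ (L₁.symm (EuclideanSpace.single (2 : Fin 3) (1 : ℝ))) 2)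
    (hax₂ : 0 ≤ (L₂.symm (-EuclideanSpace.single (2 : Fin 3) (1 : ℝ))) 2)
    -- bottom plate: steering `z₁`, slot `v₁`
    {z₁ : EuclideanSpace ℝ (Fin 3)} (hz₁ : ‖z₁‖ = 1) (hz₁e : ‖z₁ - EuclideanSpace.single (2 : Fin 3) (1 : ℝ)‖ ≤ 1 / 3)
    {v₁ : EuclideanSpace ℝ (Fin 3)} (hv₁ : v₁ ∈ fccSlots) (hv₁2 : v₁ 2 = Real.sqrt (2 / 3))
    (hsteep₁ : Real.sqrt 2 / 2 ≤ ⟪L₁ v₁, z₁⟫_ℝ)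
    (hrq₁ : ∀ m, σ₁ m = -1 → (1 / 4 : ℝ) ≤ ⟪L₁ (basalMirror (bestCapper (twinFrame L₁ (L₁ (EuclideanSpace.single (2 : Fin 3) (1 : ℝ))))
      (L₁ (EuclideanSpace.single (2 : Fin 3) (1 : ℝ))) z₁)), EuclideanSpace.single (2 : Fin 3) (1 : ℝ)⟫_ℝ)
    -- top plate: steering `z₂`, slot `v₂`
    {z₂ : EuclideanSpace ℝ (Fin 3)} (hz₂ : ‖z₂‖ = 1) (hz₂e : ‖z₂ - (-EuclideanSpace.single (2 : Fin 3) (1 : ℝ))‖ ≤ 1 / 3)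
    {v₂ : EuclideanSpace ℝ (Fin 3)} (hv₂ : v₂ ∈ fccSlots) (hv₂2 : v₂ 2 = Real.sqrt (2 / 3))
    (hsteep₂ : Real.sqrt 2 / 2 ≤ ⟪L₂ v₂, z₂⟫_ℝ)
    (hrq₂ : ∀ m, σ₂ m = -1 → (1 / 4 : ℝ) ≤ ⟪L₂ (basalMirror (bestCapper (twinFrame L₂ (L₂ (EuclideanSpace.single (2 : Fin 3) (1 : ℝ))))
      (L₂ (EuclideanSpace.single (2 : Fin 3) (1 : ℝ))) z₂)), -EuclideanSpace.single (2 : Fin 3) (1 : ℝ)⟫_ℝ)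
    -- frames apart: (i), (ii), (iii)_z
    (hapart₁ : ∀ F ∈ chainFrames z₁ L₁ v₁,
      F '' fccStacking 1 (Real.sqrt (2 / 3)) ≠ L₂ '' fccStacking 1 (Real.sqrt (2 / 3)) ∧
      F '' fccStacking 1 (Real.sqrt (2 / 3)) ≠
        (twinFrame L₂ (L₂ (EuclideanSpace.single (2 : Fin 3) (1 : ℝ)))) '' fccStacking 1 (Real.sqrt (2 / 3)))
    (hapart₂ : ∀ F ∈ chainFrames z₂ L₂ v₂,
      F '' fccStacking 1 (Real.sqrt (2 / 3)) ≠ L₁ '' fccStacking 1 (Real.sqrt (2 / 3)) ∧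
      F '' fccStacking 1 (Real.sqrt (2 / 3)) ≠
        (twinFrame L₁ (L₁ (EuclideanSpace.single (2 : Fin 3) (1 : ℝ)))) '' fccStacking 1 (Real.sqrt (2 / 3)))
    (hsep : ∀ F₁ ∈ chainFrames z₁ L₁ v₁, ∀ F₂ ∈ chainFrames z₂ L₂ v₂,
      ¬ ∃ (L : EuclideanSpace ℝ (Fin 3) ≃ₗᵢ[ℝ] EuclideanSpace ℝ (Fin 3)) (t₁ t₂ : EuclideanSpace ℝ (Fin 3)) (σ σ' : ℤ → ℤ),
        IsHaggSeq σ ∧ IsHaggSeq σ' ∧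
        F₁ '' fccStacking 1 (Real.sqrt (2 / 3)) ⊆ (fun p => L p + t₁) '' barlowStacking 1 (Real.sqrt (2 / 3)) σ ∧
        F₂ '' fccStacking 1 (Real.sqrt (2 / 3)) ⊆ (fun p => L p + t₂) '' barlowStacking 1 (Real.sqrt (2 / 3)) σ')
    (R₀ : ℝ) (hR₀ : 6 ≤ R₀) :
    ∃ step₁ step₂ : ℤ → EuclideanSpace ℝ (Fin 3),
      (∀ k, IsUpBond L₁ σ₁ (EuclideanSpace.single (2 : Fin 3) (1 : ℝ)) k (step₁ k)) ∧
      (∀ k, σ₁ k = 1 → step₁ k = v₁) ∧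
      (∀ k, σ₁ k = -1 → step₁ k = basalMirror (bestCapper (twinFrame L₁ (L₁ (EuclideanSpace.single (2 : Fin 3) (1 : ℝ))))
        (L₁ (EuclideanSpace.single (2 : Fin 3) (1 : ℝ))) z₁)) ∧
      (∀ k, (1 / 4 : ℝ) ≤ ⟪step₁ k, L₁.symm (EuclideanSpace.single (2 : Fin 3) (1 : ℝ))⟫_ℝ) ∧
      (∀ k, IsUpBond L₂ σ₂ (-EuclideanSpace.single (2 : Fin 3) (1 : ℝ)) k (step₂ k)) ∧
      (∀ k, σ₂ k = 1 → step₂ k = v₂) ∧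
      (∀ k, σ₂ k = -1 → step₂ k = basalMirror (bestCapper (twinFrame L₂ (L₂ (EuclideanSpace.single (2 : Fin 3) (1 : ℝ))))
        (L₂ (EuclideanSpace.single (2 : Fin 3) (1 : ℝ))) z₂)) ∧
      (∀ k, (1 / 4 : ℝ) ≤ ⟪step₂ k, L₂.symm (-EuclideanSpace.single (2 : Fin 3) (1 : ℝ))⟫_ℝ) ∧
      ∀ h : ℝ, 0 ≤ h → ∀ ρ : ℝ, R₀ ≤ ρ → ∀ X P₁ P₂ : Finset (EuclideanSpace ℝ (Fin 3)),
      (∀ p ∈ X, ∀ q ∈ X, p ≠ q → 1 ≤ dist p q) → P₁ ⊆ X → P₂ ⊆ X \ P₁ → (∀ p ∈ X, p ∈ cyl R₀ h ρ) →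
      (∀ p, p ∈ P₁ ↔ (p ∈ stacking L₁ s₁ σ₁ ∧ -(2 * R₀) ≤ p 2 ∧ p 2 ≤ -R₀ ∧ p 0 ^ 2 + p 1 ^ 2 ≤ ρ ^ 2)) →
      (∀ p, p ∈ P₂ ↔ (p ∈ stacking L₂ s₂ σ₂ ∧ h + R₀ ≤ p 2 ∧ p 2 ≤ h + 2 * R₀ ∧ p 0 ^ 2 + p 1 ^ 2 ≤ ρ ^ 2)) →
      ∃ (m : ℝ) (T₁ T₂ : Finset (Fin 2 → ℤ)), 0 ≤ m ∧
        (∀ t : Fin 2 → ℤ, (∃ k : ℤ,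
          -R₀ - 4 ≤ (L₁ (zigVertexS step₁ k + ((t 0 : ℝ) • triangularVec₁ 1 + (t 1 : ℝ) • triangularVec₂ 1)) + s₁) 2 ∧
          (L₁ (zigVertexS step₁ k + ((t 0 : ℝ) • triangularVec₁ 1 + (t 1 : ℝ) • triangularVec₂ 1)) + s₁) 2 ≤ -R₀ - 3 ∧
          Real.sqrt ((L₁ (zigVertexS step₁ k + ((t 0 : ℝ) • triangularVec₁ 1 + (t 1 : ℝ) • triangularVec₂ 1)) + s₁) 0 ^ 2 +
            (L₁ (zigVertexS step₁ k + ((t 0 : ℝ) • triangularVec₁ 1 + (t 1 : ℝ) • triangularVec₂ 1)) + s₁) 1 ^ 2) ≤ ρ - m) →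
          t ∈ T₁) ∧
        (∀ t : Fin 2 → ℤ, (∃ k : ℤ,
          h + R₀ + 3 ≤ (L₂ (zigVertexS step₂ k + ((t 0 : ℝ) • triangularVec₁ 1 + (t 1 : ℝ) • triangularVec₂ 1)) + s₂) 2 ∧
          (L₂ (zigVertexS step₂ k + ((t 0 : ℝ) • triangularVec₁ 1 + (t 1 : ℝ) • triangularVec₂ 1)) + s₂) 2 ≤ h + R₀ + 4 ∧
          Real.sqrt ((L₂ (zigVertexS step₂ k + ((t 0 : ℝ) • triangularVec₁ 1 + (t 1 : ℝ) • triangularVec₂ 1)) + s₂) 0 ^ 2 +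
            (L₂ (zigVertexS step₂ k + ((t 0 : ℝ) • triangularVec₁ 1 + (t 1 : ℝ) • triangularVec₂ 1)) + s₂) 1 ^ 2) ≤ ρ - m) →
          t ∈ T₂) ∧
        (T₁.card : ℝ) + T₂.card + 18 * m * ρ ≤
          (∑ y ∈ X.filter (fun y => (X.filter fun q => dist y q = 1).card ≠ 12 ∧ -R₀ - 2 ≤ y 2 ∧ y 2 ≤ h + R₀ + 2),
            ((12 : ℝ) - ((X.filter fun q => dist y q = 1).card : ℝ))) + (432 + 1728 * R₀) * (1 + h) * ρ := by
  set e₃ : EuclideanSpace ℝ (Fin 3) := EuclideanSpace.single (2 : Fin 3) (1 : ℝ) with he₃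
  have he₃n : ‖e₃‖ = 1 := by rw [he₃, PiLp.norm_single, norm_one]
  have hne : ¬ ((-1 : ℤ) = 1) := by decide
  -- the bottom plate's ∇ slot, machine steps, canonical states
  set G₁ := twinFrame L₁ (L₁ e₃) with hG₁
  set q₁ := bestCapper G₁ (L₁ e₃) z₁ with hq₁
  set ms₁ : ℤ → EuclideanSpace ℝ (Fin 3) := fun m => if σ₁ m = 1 then v₁ else basalMirror q₁ with hms₁
  set canon₁ : ℤ → EuclideanSpace ℝ (Fin 3) → EuclideanSpace ℝ (Fin 3) × List WalkEntry :=
    fun m t => if σ₁ (m - 1) = 1 then (t, [⟨L₁, v₁, 0⟩]) else (t, [⟨G₁, q₁, L₁ e₃⟩, ⟨L₁, v₁, 0⟩]) with hcanon₁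
  have hms₁₁ : ∀ m, σ₁ m = 1 → ms₁ m = v₁ := fun m hm => by simp only [hms₁, hm, if_true]
  have hms₁₂ : ∀ m, σ₁ m = -1 → ms₁ m = basalMirror q₁ := fun m hm => by simp only [hms₁, hm, hne, if_false]
  have hcanon₁₁ : ∀ m t, σ₁ (m - 1) = 1 → canon₁ m t = (t, [⟨L₁, v₁, 0⟩]) := fun m t hm => by simp only [hcanon₁, hm, if_true]
  have hcanon₁₂ : ∀ m t, σ₁ (m - 1) = -1 → canon₁ m t = (t, [⟨G₁, q₁, L₁ e₃⟩, ⟨L₁, v₁, 0⟩]) := fun m t hm => by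
    simp only [hcanon₁, hm, hne, if_false]
  have hup₁ : ∀ k, IsUpBond L₁ σ₁ e₃ k (ms₁ k) := isUpBond_machineStep_at_steer σ₁ L₁ e₃ z₁ v₁ ms₁ hσ₁ hax₁ hv₁ hv₁2 hms₁₁ hms₁₂
  have hδ₁ : ∀ m, (1 / 4 : ℝ) ≤ ⟪L₁ (ms₁ m), e₃⟫_ℝ := by
    intro m
    rcases hσ₁ m with hm | hm
    · rw [hms₁₁ m hm]
      have h := slot_ref_rise_of_tilt_wide hz₁e L₁ hv₁ hsteep₁
      linarith
    · rw [hms₁₂ m hm]; exact hrq₁ m hm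
  have hr₁ : ∀ k, (1 / 4 : ℝ) ≤ ⟪ms₁ k, L₁.symm e₃⟫_ℝ := fun k => by rw [← inner_map_eq_inner_symm]; exact hδ₁ k
  -- the top plate's ∇ slot, machine steps, canonical states
  set G₂ := twinFrame L₂ (L₂ e₃) with hG₂
  set q₂ := bestCapper G₂ (L₂ e₃) z₂ with hq₂
  set ms₂ : ℤ → EuclideanSpace ℝ (Fin 3) := fun m => if σ₂ m = 1 then v₂ else basalMirror q₂ with hms₂
  set canon₂ : ℤ → EuclideanSpace ℝ (Fin 3) → EuclideanSpace ℝ (Fin 3) × List WalkEntry :=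
    fun m t => if σ₂ (m - 1) = 1 then (t, [⟨L₂, v₂, 0⟩]) else (t, [⟨G₂, q₂, L₂ e₃⟩, ⟨L₂, v₂, 0⟩]) with hcanon₂
  have hms₂₁ : ∀ m, σ₂ m = 1 → ms₂ m = v₂ := fun m hm => by simp only [hms₂, hm, if_true]
  have hms₂₂ : ∀ m, σ₂ m = -1 → ms₂ m = basalMirror q₂ := fun m hm => by simp only [hms₂, hm, hne, if_false]
  have hcanon₂₁ : ∀ m t, σ₂ (m - 1) = 1 → canon₂ m t = (t, [⟨L₂, v₂, 0⟩]) := fun m t hm => by simp only [hcanon₂, hm, if_true]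
  have hcanon₂₂ : ∀ m t, σ₂ (m - 1) = -1 → canon₂ m t = (t, [⟨G₂, q₂, L₂ e₃⟩, ⟨L₂, v₂, 0⟩]) := fun m t hm => by
    simp only [hcanon₂, hm, hne, if_false]
  have hup₂ : ∀ k, IsUpBond L₂ σ₂ (-e₃) k (ms₂ k) := isUpBond_machineStep_at_steer σ₂ L₂ (-e₃) z₂ v₂ ms₂ hσ₂ hax₂ hv₂ hv₂2 hms₂₁ hms₂₂
  have hδ₂ : ∀ m, (1 / 4 : ℝ) ≤ ⟪L₂ (ms₂ m), -e₃⟫_ℝ := by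
    intro m
    rcases hσ₂ m with hm | hm
    · rw [hms₂₁ m hm]
      have h := slot_ref_rise_of_tilt_wide hz₂e L₂ hv₂ hsteep₂
      linarith
    · rw [hms₂₂ m hm]; exact hrq₂ m hm
  have hr₂ : ∀ k, (1 / 4 : ℝ) ≤ ⟪ms₂ k, L₂.symm (-e₃)⟫_ℝ := fun k => by rw [← inner_map_eq_inner_symm]; exact hδ₂ k
  refine ⟨ms₁, ms₂, hup₁, hms₁₁, hms₁₂, hr₁, hup₂, hms₂₁, hms₂₂, hr₂, ?_⟩
  intro h hh ρ hρ X P₁ P₂ hX hP₁X hP₂X' hcyl hP₁ hP₂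
  have hP₂X : P₂ ⊆ X := hP₂X'.trans Finset.sdiff_subset
  have hcell : ∀ p ∈ X, -(2 * R₀) ≤ p 2 ∧ p 2 ≤ h + 2 * R₀ ∧ p 0 ^ 2 + p 1 ^ 2 ≤ ρ ^ 2 := fun p hp => by
    have := hcyl p hp; simpa only [cyl, Set.mem_setOf_eq] using this
  -- the two polylines
  have hsucc₁ : ∀ k, zigVertexS ms₁ (k + 1) = zigVertexS ms₁ k + ms₁ k := fun k => zigVertexS_succ ms₁ k
  have hlayer₁ : ∀ k, zigVertexS ms₁ k ∈ barlowLayer 1 (Real.sqrt (2 / 3)) σ₁ k :=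
    zigVertexS_mem_barlowLayer_of_upBond L₁ hσ₁ e₃ hax₁ hup₁
  have hsucc₂ : ∀ k, zigVertexS ms₂ (k + 1) = zigVertexS ms₂ k + ms₂ k := fun k => zigVertexS_succ ms₂ k
  have hlayer₂ : ∀ k, zigVertexS ms₂ k ∈ barlowLayer 1 (Real.sqrt (2 / 3)) σ₂ k :=
    zigVertexS_mem_barlowLayer_of_upBond L₂ hσ₂ (-e₃) hax₂ hup₂
  -- the two-family line count with explicit margin
  have hq : (1 : ℝ) / 4 > 0 := by norm_num
  obtain ⟨T₁, T₂, hT₁, hT₂, hcount⟩ := barlow_lineCount_le_payers_apart_tiltWide hX hsE hcert hDS hCP hσ₁ hσ₂ L₁ L₂ s₁ s₂ R₀ h ρ hR₀ hh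
    (by linarith) P₁ P₂ hP₁X hP₂X hcell hP₁ hP₂ hz₁ hz₁e v₁ canon₁ ms₁ hv₁ hv₁2 hsteep₁ hcanon₁₁ hcanon₁₂ hms₁₁ hms₁₂ hq hδ₁
    hz₂ hz₂e v₂ canon₂ ms₂ hv₂ hv₂2 hsteep₂ hcanon₂₁ hcanon₂₂ hms₂₁ hms₂₂ hq hδ₂ hapart₁ hapart₂ hsep
    (zigVertexS ms₁) (zigVertexS ms₂) hsucc₁ hlayer₁ hsucc₂ hlayer₂
  have hmin : min (1 / 4 : ℝ) (1 / 4) = 1 / 4 := min_self _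
  rw [hmin] at hT₁ hT₂
  set m : ℝ := 3 + 24 * (h + 4 * R₀) + 3 / (1 / 4) with hm
  have hmval : m = 15 + 24 * h + 96 * R₀ := by rw [hm]; ring
  have hm0 : 0 ≤ m := by rw [hmval]; nlinarith
  have hρ0 : 0 ≤ ρ := by linarith
  refine ⟨m, T₁, T₂, hm0, hT₁, hT₂, ?_⟩
  have hpen : 18 * m * ρ ≤ (432 + 1728 * R₀) * (1 + h) * ρ := by
    rw [hmval]
    have h1 : 18 * (15 + 24 * h + 96 * R₀) ≤ (432 + 1728 * R₀) * (1 + h) := by nlinarith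
    exact mul_le_mul_of_nonneg_right h1 hρ0
  linarith

end Summit.Ventures.Crystal3D.Theorems

end
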